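import Summits.Ventures.HSemireg.UntwistCocycleTwistSigmaHigher
import Summits.Ventures.HSemireg.UntwistAtiyahStepCommuteLocFree
import Summits.Ventures.HSemireg.UntwistAtiyahStepCommuteTwist
import Literature.AlgebraicGeometry.Crystalline.HodgeSheavesTorsionFree
import Literature.AlgebraicGeometry.Motives.HodgeSheavesFree
import HarnessLib

/-!
# Venture HSemireg — route R1.0, untwisted reading: **`I`-semiregularity of `E` iff of `E ⊗ M` for EVERY lower set
# `I`, UNCONDITIONALLY when the Hodge sheaves `Ωʲ_{X/S}` are finite locally free** — th-4's binder `hσ` (the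
# Leibniz re-expansion, `UntwistCocycleTwistSigma.isISemiregular_iff_twist`) DISCHARGED in all form degrees
# (gs-g4; end of `general-structure/LEIBNIZ-ROW2-PLAN-gs-g4.md`)

HONEST FRAMING. Module-level homological algebra on the tree's REAL carriers (`sigmaHigher`, `IsISemiregular` of
`HodgeTheory/SemiregularityHigherSigma.lean`, th-4's cocycle twist `E⟨c⟩ = twist c E` = `E ⊗ M_B` on the internal-Hom
models). Nothing about any variety; no gerbe; nothing here says HC, HC_CM or HC_AV is proved.

WHAT IS PROVED (no `def`). For a cocycle `c`, a finite locally free `E`, and `Ωʲ_{X/S}` finite locally free for all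
`j` (`hΩ`; e.g. `X/S` smooth — `Crystalline.isFiniteLocallyFree_hodgeSheaf`, `Motives/HodgeSheavesFree`):
* `traceExtCoeff_sigma_twist_exists` — for every `q` there are additive `V_i` with
  `Tr′_{Ω^q}((θx · ι′) · At(E⟨c⟩)^q) = Tr_{Ω^q}((x · ι) · At(E)^q) + Σ_{i<q} V_i(Tr_{Ωⁱ}((x · ι) · At(E)^i))` for all
  `x ∈ Ext²(E, E)` — the row `q` of `hσ` on the `Ext`-level carriers: `UntwistCocycleTwistSigmaHigher` on the point
  cover `W_x = U_x ∩ U^E_x ∩ ⋂_{j ≤ q} U^{Ωʲ}_x` (frames of `E`, coframes of `Ω^{≤ q}`, the framing `e_x ≫ t_x` of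
  `E⟨c⟩`), the centrality input being th-4's `atiyahClassStep_comp_wedgeClass_of_coframes` with `θ := dlog`
  (`dlogForm_face_cocycle`);
* **`isISemiregular_iff_twist_of_locallyFree`** — **`IsISemiregular(E, I) ↔ IsISemiregular(E ⊗ M, I)` for every
  LOWER set `I ⊆ ℕ`** (`UntwistCocycleTwistSigmaHigher.isISemiregular_iff_twist_of_exists`), in particular
  `isISemiregular_univ_iff_twist_of_locallyFree` (FULL semiregularity) and `isISemiregular_Iio_iff_twist_of_locallyFree`
  (the `p`-adic notion `I = {q < p}`); and with `hΩ` discharged: `isISemiregular_iff_twist_of_smooth` (`X → Spec K`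
  smooth of relative dimension `d`, Mathlib `SmoothOfRelativeDimension`, via `Crystalline.isFiniteLocallyFree_hodgeSheaf`)
  and `isISemiregular_iff_twist_of_cotangentSheaf_free` (`Ω¹ ≅ 𝒪^J`, e.g. abelian schemes — the STEP-0 anchor).

So the ONE binder of th-4's untwisted reading of route R1.0 on sheaf carriers (`hσ` of `isISemiregular_iff_twist`, th-4
file #13) is gone for `X/S` with locally free Hodge sheaves: rows `q = 0` (th-4 #17), `q = 1` (`UntwistCocycleTwistSigmaOne`)
and now all `q`. What stays outside: the complex-carrier version (`IsISemiregularC`), the gerbe side (odd `m`), and any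
semiregularity THEOREM (Bloch / Buchweitz–Flenner 5.1 / Pridham) — this is transport of the hypothesis, not the theorem.

## References

* R.-O. Buchweitz, H. Flenner, *A semiregularity map for modules and applications to deformations*, Compositio
  Math. 137 (2003), §4, Def. 4.1, §5 (`I`-semiregular). [BuchweitzFlenner2003]
* M. F. Atiyah, *Complex analytic connections in fibre bundles*, Trans. AMS 85 (1957), Prop. 10, Prop. 12. [Atiyah1957]
* R. Hartshorne, *Algebraic Geometry* (1977), III Prop. 6.3. [Hartshorne1977]
-/

noncomputable section

open CategoryTheory CategoryTheory.Abelian AlgebraicGeometry Opposite TopologicalSpace Limits Finset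

namespace Summit.Ventures.HSemireg

namespace CocycleTwist

open Literature.AlgebraicGeometry.Modules Literature.AlgebraicGeometry.Motives
  Literature.AlgebraicGeometry.HodgeTheory Literature.AlgebraicGeometry.Modules.Cech Literature.Algebra.Homology
  AtiyahStepCommute

universe u

variable {S : Type u} [CommRing S] {X : Over (Spec (CommRingCat.of S))} [HasExt.{u + 1} X.left.Modules]
  (c : UnitCocycle X.left) {E : X.left.Modules} (hE : IsFiniteLocallyFree E)
  (hΩ : ∀ j, IsFiniteLocallyFree (hodgeSheaf X j))

include hΩ in
/-- **The row `q` of the Leibniz re-expansion `hσ` on the `Ext`-level carriers, unconditionally for locally free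
`Ωʲ`**: there are additive `V_i : Ext^{i+2}(𝒪_X, Ωⁱ) → Ext^{q+2}(𝒪_X, Ω^q)` with
`Tr′_{Ω^q}((θx · ι′) · At(E⟨c⟩)^q) = Tr_{Ω^q}((x · ι) · At(E)^q) + Σ_{i<q} V_i(Tr_{Ωⁱ}((x · ι) · At(E)^i))` for every
`x ∈ Ext²(E, E)` — on the point cover `W_x = U_x ∩ U^E_x ∩ ⋂_{j ≤ q} U^{Ωʲ}_x` with the restricted frames / coframes and the
framing `e_x ≫ t_x` of `E⟨c⟩`; centrality from th-4's `atiyahClassStep_comp_wedgeClass_of_coframes` (`θ := dlog`).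
[cite: BuchweitzFlenner2003, Def. 4.1; Atiyah1957, Prop. 10 and Prop. 12] -/
theorem traceExtCoeff_sigma_twist_exists (q : ℕ) :
    ∃ V : ∀ i, Ext.{u + 1} (unitModule X.left) (hodgeSheaf X i) (i + 2) →+
        Ext.{u + 1} (unitModule X.left) (hodgeSheaf X q) (q + 2),
      ∀ x : Ext.{u + 1} E E 2,
        traceExtCoeff (isFiniteLocallyFree_twist c hE) (hodgeSheaf X q) (q + 2)
            ((((twistEquivalence X.left c).functor.mapExtAddHom E E 2 x).comp
              (Ext.mk₀ (toTwistHodgeZero (twist c E))) (add_zero 2)).comp (atiyahClassPower (twist c E) q)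
              (add_comm 2 q)) =
          traceExtCoeff hE (hodgeSheaf X q) (q + 2)
              ((x.comp (Ext.mk₀ (toTwistHodgeZero E)) (add_zero 2)).comp (atiyahClassPower E q) (add_comm 2 q)) +
            ∑ i ∈ range q, V i (traceExtCoeff hE (hodgeSheaf X i) (i + 2)
              ((x.comp (Ext.mk₀ (toTwistHodgeZero E)) (add_zero 2)).comp (atiyahClassPower E i) (add_comm 2 i))) := by
  classical
  -- the point cover `W_x = U_x ∩ U^E_x ∩ ⋂_{j ≤ q} U^{Ωʲ}_x`
  let W : X.left → X.left.Opens := fun x =>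
    (c.U x ⊓ trivNbhd hE x) ⊓ (Finset.range (q + 1)).inf fun j => trivNbhd (hΩ j) x
  have hWU : ∀ x, W x ≤ c.U x := fun x => inf_le_left.trans inf_le_left
  have hWE : ∀ x, W x ≤ trivNbhd hE x := fun x => inf_le_left.trans inf_le_right
  have hWΩ : ∀ (j : ℕ) (x : X.left), j ≤ q → W x ≤ trivNbhd (hΩ j) x := fun j x hj =>
    inf_le_right.trans (Finset.inf_le (Finset.mem_range.mpr (Nat.lt_succ_of_le hj)))
  have hW : iSup W = ⊤ := by
    refine top_le_iff.mp fun x _ => Opens.mem_iSup.2 ⟨x, ⟨c.mem x, mem_trivNbhd hE x⟩, ?_⟩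
    rw [Opens.coe_finset_inf, Finset.inf_eq_iInf]
    simp only [Function.comp_apply, Set.iInf_eq_iInter, Set.mem_iInter, SetLike.mem_coe]
    exact fun j _ => mem_trivNbhd (hΩ j) x
  -- restricted frames of `E`, coframes of `Ωʲ` (`j ≤ q`), and the framing `e_x ≫ t_x` of `E⟨c⟩` on `W_x`
  let e : ∀ x, SheafOfModules.free (TrivIndex hE x) ≅ E.over (W x) := fun x =>
    SheafOfModules.restrictTrivialisation (R := X.left.ringCatSheaf) (homOfLE (hWE x)) (trivFrame hE x)
  let w : ∀ (j : ℕ) (x : X.left), j ≤ q → (SheafOfModules.free (TrivIndex (hΩ j) x) ≅ (hodgeSheaf X j).over (W x)) :=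
    fun j x hj => SheafOfModules.restrictTrivialisation (R := X.left.ringCatSheaf) (homOfLE (hWΩ j x hj))
      (trivFrame (hΩ j) x)
  let 𝔢 : Framing (twist c E) X.left :=
    { U := W
      I := fun x => TrivIndex hE x
      e := fun x => e x ≪≫ twistTrivOver c E x (W x) (hWU x) }
  refine traceExtCoeff_sigma_twist_exists_of_cover c hE W hWU hW q e w (fun m hm => ?_) q le_rfl
  -- centrality at level `m` (th-4 (L5), arbitrary coframes, `θ := dlog`)
  exact atiyahClassStep_comp_wedgeClass_of_coframes (E := twist c E) (j := m) 𝔢 hW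
    (fun x => w m x (by omega)) (fun x => w (m + 1) x (by omega)) _ (dlogForm_face_cocycle c W hWU)

include hΩ in
/-- **`I`-semiregularity of `E` iff of `E ⊗ M`, for every LOWER set `I` of form degrees, unconditionally when the
`Ωʲ_{X/S}` are finite locally free**: th-4's `isISemiregular_iff_twist` (file #13 §2) with its ONE binder — the Leibniz
re-expansion `hσ` — DISCHARGED in all degrees (rows `traceExtCoeff_sigma_twist_exists` fed to
`isISemiregular_iff_twist_of_exists`). [cite: BuchweitzFlenner2003, §5 (I-semiregular); Atiyah1957, Prop. 10 and Prop. 12] -/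
theorem isISemiregular_iff_twist_of_locallyFree {I : Set ℕ} (hI : IsLowerSet I) :
    IsISemiregular.{u + 1} hE I ↔ IsISemiregular.{u + 1} (isFiniteLocallyFree_twist c hE) I :=
  isISemiregular_iff_twist_of_exists c hE hI fun q _ => traceExtCoeff_sigma_twist_exists c hE hΩ q

include hΩ in
/-- **FULL semiregularity (`I = univ`: all `σ_q` jointly injective) of `E` iff of `E ⊗ M`**, unconditionally for locally
free `Ωʲ`. [cite: BuchweitzFlenner2003, Def. 4.1 and §5] -/
theorem isISemiregular_univ_iff_twist_of_locallyFree :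
    IsISemiregular.{u + 1} hE Set.univ ↔ IsISemiregular.{u + 1} (isFiniteLocallyFree_twist c hE) Set.univ :=
  isISemiregular_iff_twist_of_locallyFree c hE hΩ isLowerSet_univ

include hΩ in
/-- **`{q < p}`-semiregularity (the `p`-adic notion) of `E` iff of `E ⊗ M`**, unconditionally for locally free `Ωʲ`.
[cite: BuchweitzFlenner2003, §5 (I-semiregular)] -/
theorem isISemiregular_Iio_iff_twist_of_locallyFree (p : ℕ) :
    IsISemiregular.{u + 1} hE (Set.Iio p) ↔ IsISemiregular.{u + 1} (isFiniteLocallyFree_twist c hE) (Set.Iio p) :=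
  isISemiregular_iff_twist_of_locallyFree c hE hΩ (isLowerSet_Iio p)

include hΩ in
/-- **`q`-semiregularity for all `q ≤ p` at once (`I = {0, …, p}`) of `E` iff of `E ⊗ M`**, unconditionally for locally
free `Ωʲ` (rows `0, 1` recover th-4 #17 and `UntwistCocycleTwistSigmaOne.isISemiregular_Iic_one_iff_twist`).
[cite: BuchweitzFlenner2003, §5 (I-semiregular)] -/
theorem isISemiregular_Iic_iff_twist_of_locallyFree (p : ℕ) :
    IsISemiregular.{u + 1} hE (Set.Iic p) ↔ IsISemiregular.{u + 1} (isFiniteLocallyFree_twist c hE) (Set.Iic p) :=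
  isISemiregular_iff_twist_of_locallyFree c hE hΩ (isLowerSet_Iic p)

/-- **Smooth case**: for `X → Spec K` smooth of relative dimension `d` (Mathlib `SmoothOfRelativeDimension`; then every
`Ωʲ_{X/K}` is finite locally free, `Crystalline.isFiniteLocallyFree_hodgeSheaf`), `I`-semiregularity of `E` iff of
`E ⊗ M` for every lower set `I` — no hypothesis left besides smoothness. [cite: BuchweitzFlenner2003, §5 (I-semiregular); Hartshorne1977, II Thm. 8.15] -/
theorem isISemiregular_iff_twist_of_smooth (d : ℕ) [SmoothOfRelativeDimension d X.hom] {I : Set ℕ}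
    (hI : IsLowerSet I) :
    IsISemiregular.{u + 1} hE I ↔ IsISemiregular.{u + 1} (isFiniteLocallyFree_twist c hE) I :=
  isISemiregular_iff_twist_of_locallyFree c hE
    (Literature.AlgebraicGeometry.Crystalline.isFiniteLocallyFree_hodgeSheaf X d) hI

/-- **`Ω¹`-free case** (e.g. abelian schemes — the STEP-0 / `g = 4` anchor: translation-invariant `1`-forms trivialise
`Ω¹_{A/k}`; then every `Ωʲ` is finite locally free, `isFiniteLocallyFree_hodgeSheaf_of_cotangentSheaf_free`):
`I`-semiregularity of `E` iff of `E ⊗ M` for every lower set `I`. [cite: BuchweitzFlenner2003, §5 (I-semiregular)] -/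
theorem isISemiregular_iff_twist_of_cotangentSheaf_free {J : Type u} [Finite J]
    (h : Nonempty (cotangentSheaf X ≅ SheafOfModules.free J)) {I : Set ℕ} (hI : IsLowerSet I) :
    IsISemiregular.{u + 1} hE I ↔ IsISemiregular.{u + 1} (isFiniteLocallyFree_twist c hE) I :=
  isISemiregular_iff_twist_of_locallyFree c hE (isFiniteLocallyFree_hodgeSheaf_of_cotangentSheaf_free X h) hI

end CocycleTwist

end Summit.Ventures.HSemireg

end
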